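import Mathlib
import Summits.AtomisticToContinuum.Crystallization.Theorems.GappedShellCensusFiveFoldRationingRStubFfrC5KillsAux

/-!
# Crux `GappedShellCensus.FiveFoldRationingR` (stmt-AtomisticToContinuum-18071), line `Sketch` —
# helpers for stub `stub_ffrC5Kills` (angle-budget kills on abstract fan data), part 2

On abstract fan data (see part 1): the local pictures of the three sector types at a label `v` —
an `H`-pair around a non-partner `x` of the link (`ffrK_hpair`), a quad corner (`ffrK_qtri`) and
its closing fourth vertex (`ffrK_qclose`) — and the pure bond-graph WALK `stub_ffrC5KillsWalk`
(registered sub-goal): at a five-valent label whose partners-bonded-to-partners graph has degrees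
`(1, 1, 2, 2, 2)` with the two degree-one partners not bonded, the graph is a Hamiltonian path,
i.e. the configuration is an open `4T+Q` star, excluded by the certificate hypothesis
`noOpenStar`.
-/

noncomputable section

namespace Summit.AtomisticToContinuum.Crystallization.Theorems

open Real

/-! ### The three sector types at a label -/

/-- **`H`-pair around a non-partner of the link.** If `x ≠ v` is not bonded to `v` but lies in a
fan triangle at `v` (and `v` has bond-degree `≥ 4`), then the two fan triangles through `v, x`
are `{v, x, a}` and `{v, x, z}` with `a ≠ z` bond partners of `v` bonded to `x` and NOT bonded
to each other (a bond `a z` would close a 3-cycle `a x z` in the link of `v`). [folklore] -/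
theorem ffrK_hpair (bond : Fin 12 → Fin 12 → Bool) (tri : Finset (Finset (Fin 12)))
    (bond_symm : ∀ v w, bond v w = bond w v) (bond_irrefl : ∀ v, bond v v = false)
    (tri_card : ∀ S ∈ tri, S.card = 3)
    (two_per_side : ∀ S ∈ tri, ∀ s ⊆ S, s.card = 2 → (tri.filter fun S' => s ⊆ S').card = 2)
    (bond_side : ∀ v w, bond v w = true →
      (tri.filter fun S' => ({v, w} : Finset (Fin 12)) ⊆ S').card = 2)
    (bond_tri : ∀ a b c, a ≠ b → b ≠ c → a ≠ c → bond a b = true → bond b c = true → bond a c = true →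
      ({a, b, c} : Finset (Fin 12)) ∈ tri)
    (link : ∀ v, ∀ A ⊆ tri.filter (fun S => v ∈ S), A.Nonempty →
      (∀ S ∈ A, ∀ S' ∈ tri, v ∈ S' → (S ∩ S').card = 2 → S' ∈ A) → A = tri.filter fun S => v ∈ S)
    (two_bond_sides : ∀ S ∈ tri, ∃ a ∈ S, ∀ b ∈ S, b ≠ a → bond a b = true)
    {v x : Fin 12} (hP : 4 ≤ (Finset.univ.filter fun w => bond v w = true).card)
    (hxv : x ≠ v) (hvx : bond v x = false)
    {S₀ : Finset (Fin 12)} (hS₀ : S₀ ∈ tri) (hvS₀ : v ∈ S₀) (hxS₀ : x ∈ S₀) :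
    ∃ a z : Fin 12, ((tri.filter fun S => v ∈ S).filter fun S => x ∈ S) = {{v, x, a}, {v, x, z}} ∧
      ({v, x, a} : Finset (Fin 12)) ≠ {v, x, z} ∧
      ({v, x, a} : Finset (Fin 12)) ∈ tri ∧ ({v, x, z} : Finset (Fin 12)) ∈ tri ∧
      a ≠ v ∧ a ≠ x ∧ z ≠ v ∧ z ≠ x ∧ a ≠ z ∧
      bond v a = true ∧ bond a x = true ∧ bond v z = true ∧ bond z x = true ∧ bond a z = false := by
  have h2 := ffrK_fib_two tri two_per_side hS₀ hvS₀ hxS₀ hxv.symm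
  obtain ⟨S₁, S₂, hne, heq⟩ := Finset.card_eq_two.1 h2
  have hS₁ : S₁ ∈ (tri.filter fun S => v ∈ S).filter fun S => x ∈ S := by rw [heq]; simp
  have hS₂ : S₂ ∈ (tri.filter fun S => v ∈ S).filter fun S => x ∈ S := by rw [heq]; simp
  simp only [Finset.mem_filter] at hS₁ hS₂
  obtain ⟨a, hav, hax, rfl⟩ := ffrK_third (tri_card _ hS₁.1.1) hS₁.1.2 hS₁.2 hxv.symm
  obtain ⟨z, hzv, hzx, rfl⟩ := ffrK_third (tri_card _ hS₂.1.1) hS₂.1.2 hS₂.2 hxv.symm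
  obtain ⟨hva, hax'⟩ := ffrK_tbs bond tri bond_symm two_bond_sides hS₁.1.1 hxv hav hax hvx
  obtain ⟨hvz, hzx'⟩ := ffrK_tbs bond tri bond_symm two_bond_sides hS₂.1.1 hxv hzv hzx hvx
  have haz : a ≠ z := fun h => hne (by rw [h])
  refine ⟨a, z, heq, hne, hS₁.1.1, hS₂.1.1, hav, hax, hzv, hzx, haz, hva, hax', hvz, hzx', ?_⟩
  rcases Bool.eq_false_or_eq_true (bond a z) with h | h
  · exfalso
    have h3 : ({v, z, a} : Finset (Fin 12)) ∈ tri :=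
      bond_tri v z a hzv.symm haz.symm hav.symm hvz (by rw [bond_symm]; exact h) hva
    have h1 : ({v, a, x} : Finset (Fin 12)) ∈ tri := by rw [ffrK_swap]; exact hS₁.1.1
    exact ffrK_link3 bond tri bond_irrefl two_per_side bond_side link hP hav hxv hzv hax
      hzx.symm haz.symm h1 hS₂.1.1 h3
  · exact h

/-- **A quad corner.** A triangle at `v` whose other two vertices are bond partners of `v` but
which is not a bond triangle is `{v, d, a}` with `d a` not a bond. [folklore] -/
theorem ffrK_qtri (bond : Fin 12 → Fin 12 → Bool) (tri : Finset (Finset (Fin 12)))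
    (bond_symm : ∀ v w, bond v w = bond w v) (tri_card : ∀ S ∈ tri, S.card = 3)
    {v : Fin 12} {S : Finset (Fin 12)} (hS : S ∈ tri) (hvS : v ∈ S)
    (hC : ∀ w ∈ S, w ≠ v → bond v w = true)
    (hnF : ¬ ∀ p ∈ S, ∀ q ∈ S, p ≠ q → bond p q = true) :
    ∃ d a : Fin 12, S = {v, d, a} ∧ d ≠ v ∧ a ≠ v ∧ a ≠ d ∧
      bond v d = true ∧ bond v a = true ∧ bond d a = false := by
  have hcard := tri_card S hS
  have hne : (S.erase v).Nonempty := by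
    rw [← Finset.card_pos, Finset.card_erase_of_mem hvS, hcard]; norm_num
  obtain ⟨d, hd⟩ := hne
  rw [Finset.mem_erase] at hd
  obtain ⟨a, hav, had, hSeq⟩ := ffrK_third hcard hvS hd.2 hd.1.symm
  have hvd : bond v d = true := hC d hd.2 hd.1
  have hva : bond v a = true := hC a (by rw [hSeq]; simp) hav
  refine ⟨d, a, hSeq, hd.1, hav, had, hvd, hva, ?_⟩
  rcases Bool.eq_false_or_eq_true (bond d a) with h | h
  · exfalso
    apply hnF
    rw [hSeq]
    exact ffrK_fb_triple bond bond_symm v d a hvd h hva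
  · exact h

/-- **The fourth vertex of a quad.** If `{v, d, a}` is a fan triangle at a label `v` of
bond-degree `≥ 4` with `v d`, `v a` bonds and `d a` not a bond, the second fan triangle through
the side `{d, a}` is `{d, a, x}` with `x` bonded to `d` and `a` (face condition) and not bonded
to `v` (else `d x a` would be a 3-cycle in the link of `v`). [folklore] -/
theorem ffrK_qclose (bond : Fin 12 → Fin 12 → Bool) (tri : Finset (Finset (Fin 12)))
    (bond_symm : ∀ v w, bond v w = bond w v) (bond_irrefl : ∀ v, bond v v = false)
    (tri_card : ∀ S ∈ tri, S.card = 3)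
    (two_per_side : ∀ S ∈ tri, ∀ s ⊆ S, s.card = 2 → (tri.filter fun S' => s ⊆ S').card = 2)
    (bond_side : ∀ v w, bond v w = true →
      (tri.filter fun S' => ({v, w} : Finset (Fin 12)) ⊆ S').card = 2)
    (bond_tri : ∀ a b c, a ≠ b → b ≠ c → a ≠ c → bond a b = true → bond b c = true → bond a c = true →
      ({a, b, c} : Finset (Fin 12)) ∈ tri)
    (link : ∀ v, ∀ A ⊆ tri.filter (fun S => v ∈ S), A.Nonempty →
      (∀ S ∈ A, ∀ S' ∈ tri, v ∈ S' → (S ∩ S').card = 2 → S' ∈ A) → A = tri.filter fun S => v ∈ S)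
    (two_bond_sides : ∀ S ∈ tri, ∃ a ∈ S, ∀ b ∈ S, b ≠ a → bond a b = true)
    {v d a : Fin 12} (hP : 4 ≤ (Finset.univ.filter fun w => bond v w = true).card)
    (hS : ({v, d, a} : Finset (Fin 12)) ∈ tri) (hdv : d ≠ v) (hav : a ≠ v) (had : a ≠ d)
    (hvd : bond v d = true) (hva : bond v a = true) (hda : bond d a = false) :
    ∃ x, bond d x = true ∧ bond x a = true ∧ bond v x = false ∧ x ≠ v := by
  obtain ⟨Y, hY, hdY, haY, hYS, -⟩ :=
    ffrK_fib_cases tri two_per_side hS (v := d) (w := a) (by simp) (by simp) had.symm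
  obtain ⟨x, hxd, hxa, rfl⟩ := ffrK_third (tri_card Y hY) hdY haY had.symm
  have hxv : x ≠ v := by
    rintro rfl
    exact hYS (by rw [ffrK_rot, ffrK_rot])
  -- face condition on `{d, a, x}`: `x` is the vertex bonded to the other two
  obtain ⟨c, hc, hcb⟩ := two_bond_sides _ hY
  have hxd' : bond x d = true ∧ bond x a = true := by
    simp only [Finset.mem_insert, Finset.mem_singleton] at hc
    rcases hc with rfl | rfl | rfl
    · have h := hcb a (by simp) had
      rw [hda] at h
      exact absurd h Bool.false_ne_true
    · have h := hcb d (by simp) had.symm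
      rw [bond_symm, hda] at h
      exact absurd h Bool.false_ne_true
    · exact ⟨hcb d (by simp) hxd.symm, hcb a (by simp) hxa.symm⟩
  refine ⟨x, by rw [bond_symm]; exact hxd'.1, hxd'.2, ?_, hxv⟩
  rcases Bool.eq_false_or_eq_true (bond v x) with h | h
  · exfalso
    have h1 : ({v, d, x} : Finset (Fin 12)) ∈ tri :=
      bond_tri v d x hdv.symm hxd.symm hxv.symm hvd (by rw [bond_symm]; exact hxd'.1) h
    have h2 : ({v, x, a} : Finset (Fin 12)) ∈ tri :=
      bond_tri v x a hxv.symm hxa hav.symm h hxd'.2 hva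
    have h3 : ({v, a, d} : Finset (Fin 12)) ∈ tri := by rw [ffrK_swap]; exact hS
    exact ffrK_link3 bond tri bond_irrefl two_per_side bond_side link hP hdv hxv hav hxd.symm hxa
      had h1 h2 h3
  · exact h

/-! ### The open star at a five-valent label with four bond triangles -/

/-- **Registered sub-goal: the walk (pure bond-graph statement).** Let `v` have exactly five bond partners, among them
`a ≠ z` not bonded to each other, let `x` (not a partner, `x ≠ v`) be bonded to `a` and `z`, and
suppose: `a` and `z` each have at most one partner of `v` bonded to them, `a` has one, and every
other partner `p` has exactly two.  Then the partners bonded-to-partners graph is a path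
`a – b – m – r – z` through all five partners, and `v, z, r, m, b, a, x` is an open `4T+Q` star —
excluded by `noOpenStar`. [folklore] -/
theorem stub_ffrC5KillsWalk (bond : Fin 12 → Fin 12 → Bool)
    (bond_symm : ∀ v w, bond v w = bond w v) (bond_irrefl : ∀ v, bond v v = false)
    (noOpenStar : ∀ v a₁ a₂ a₃ a₄ a₅ x : Fin 12, Function.Injective ![v, a₁, a₂, a₃, a₄, a₅, x] →
      bond v a₁ = true → bond v a₂ = true → bond v a₃ = true → bond v a₄ = true → bond v a₅ = true →
      bond a₁ a₂ = true → bond a₂ a₃ = true → bond a₃ a₄ = true → bond a₄ a₅ = true →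
      bond a₅ a₁ = false → bond x a₅ = true → bond x a₁ = true → bond v x = false → False)
    (v a z x : Fin 12) (hP5 : (Finset.univ.filter fun w => bond v w = true).card = 5)
    (hva : bond v a = true) (hvz : bond v z = true) (haz : a ≠ z) (hazb : bond a z = false)
    (hxa : bond x a = true) (hxz : bond x z = true) (hvx : bond v x = false) (hxv : x ≠ v)
    (huniqA : ∀ s s', bond v s = true → bond v s' = true → bond a s = true → bond a s' = true → s = s')
    (huniqZ : ∀ s s', bond v s = true → bond v s' = true → bond z s = true → bond z s' = true → s = s')
    (hexA : ∃ b, bond v b = true ∧ bond a b = true)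
    (hdeg2 : ∀ p, bond v p = true → p ≠ a → p ≠ z → ∃ s₁ s₂, s₁ ≠ s₂ ∧ bond v s₁ = true ∧
      bond v s₂ = true ∧ bond p s₁ = true ∧ bond p s₂ = true ∧
      ∀ s, bond v s = true → bond p s = true → s = s₁ ∨ s = s₂) :
    False := by
  have ne_of_bond : ∀ {p q : Fin 12}, bond p q = true → p ≠ q := fun h e => by
    rw [e, bond_irrefl] at h
    exact Bool.false_ne_true h
  have ne_x : ∀ {p : Fin 12}, bond v p = true → p ≠ x := fun h e => by
    rw [e, hvx] at h
    exact Bool.false_ne_true h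
  set P := Finset.univ.filter (fun w => bond v w = true) with hPdef
  have memP : ∀ w, w ∈ P ↔ bond v w = true := fun w => by simp [hPdef]
  -- the partner `b` bonded to `a`
  obtain ⟨b, hvb, hab⟩ := hexA
  have hba : b ≠ a := (ne_of_bond hab).symm
  have hbz : b ≠ z := fun e => by
    rw [e, hazb] at hab
    exact Bool.false_ne_true hab
  have hab' : bond b a = true := by rw [bond_symm]; exact hab
  -- the second partner `m` bonded to `b`
  obtain ⟨m, hma, hvm, hbm, hallb⟩ : ∃ m, m ≠ a ∧ bond v m = true ∧ bond b m = true ∧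
      ∀ s, bond v s = true → bond b s = true → s = a ∨ s = m := by
    obtain ⟨s₁, s₂, h12, hvs₁, hvs₂, hbs₁, hbs₂, hall⟩ := hdeg2 b hvb hba hbz
    rcases hall a hva hab' with h | h
    · refine ⟨s₂, ?_, hvs₂, hbs₂, fun s hs hs' => ?_⟩
      · rw [h]; exact h12.symm
      · rw [h]; exact hall s hs hs'
    · refine ⟨s₁, ?_, hvs₁, hbs₁, fun s hs hs' => ?_⟩
      · rw [h]; exact h12
      · rw [h]; exact (hall s hs hs').symm
  have hmb : m ≠ b := (ne_of_bond hbm).symm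
  -- the two remaining partners `p, p'`
  have hsub : ({a, z, b} : Finset (Fin 12)) ⊆ P := by
    intro w hw
    simp only [Finset.mem_insert, Finset.mem_singleton] at hw
    rw [memP]
    rcases hw with h | h | h <;> rw [h] <;> assumption
  have hcard3 : ({a, z, b} : Finset (Fin 12)).card = 3 :=
    Finset.card_eq_three.2 ⟨a, z, b, haz, hba.symm, hbz.symm, rfl⟩
  have hsd : (P \ {a, z, b}).card = 2 := by
    rw [Finset.card_sdiff_of_subset hsub, hP5, hcard3]
  obtain ⟨p, p', hpp', hpe⟩ := Finset.card_eq_two.1 hsd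
  have hp : p ∈ P \ {a, z, b} := by rw [hpe]; simp
  have hp' : p' ∈ P \ {a, z, b} := by rw [hpe]; simp
  simp only [Finset.mem_sdiff, memP, Finset.mem_insert, Finset.mem_singleton, not_or] at hp hp'
  obtain ⟨hvp, hpa, hpz, hpb⟩ := hp
  obtain ⟨hvp', hp'a, hp'z, hp'b⟩ := hp'
  have memP5 : ∀ w, bond v w = true → w = a ∨ w = z ∨ w = b ∨ w = p ∨ w = p' := by
    intro w hw
    by_cases h : w ∈ ({a, z, b} : Finset (Fin 12))
    · simp only [Finset.mem_insert, Finset.mem_singleton] at h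
      tauto
    · have hw' : w ∈ P \ {a, z, b} := Finset.mem_sdiff.2 ⟨(memP w).2 hw, h⟩
      rw [hpe] at hw'
      simp only [Finset.mem_insert, Finset.mem_singleton] at hw'
      tauto
  -- the tail of the walk, for `m = p` (and, by symmetry, `m = p'`)
  have tail : ∀ p p' : Fin 12, bond v p = true → p ≠ a → p ≠ z → p ≠ b → bond v p' = true →
      p' ≠ a → p' ≠ z → p' ≠ b → p ≠ p' →
      (∀ w, bond v w = true → w = a ∨ w = z ∨ w = b ∨ w = p ∨ w = p') →
      bond b p = true → (∀ s, bond v s = true → bond b s = true → s = a ∨ s = p) → False := by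
    intro p p' hvp hpa hpz hpb hvp' hp'a hp'z hp'b hpp' memP5 hbp hallb
    -- the second partner `r` bonded to `p`
    obtain ⟨r, hrb, hvr, hpr, hallp⟩ : ∃ r, r ≠ b ∧ bond v r = true ∧ bond p r = true ∧
        ∀ s, bond v s = true → bond p s = true → s = b ∨ s = r := by
      obtain ⟨s₁, s₂, h12, hvs₁, hvs₂, hps₁, hps₂, hall⟩ := hdeg2 p hvp hpa hpz
      have hpb' : bond p b = true := by rw [bond_symm]; exact hbp
      rcases hall b hvb hpb' with h | h
      · refine ⟨s₂, ?_, hvs₂, hps₂, fun s hs hs' => ?_⟩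
        · rw [h]; exact h12.symm
        · rw [h]; exact hall s hs hs'
      · refine ⟨s₁, ?_, hvs₁, hps₁, fun s hs hs' => ?_⟩
        · rw [h]; exact h12
        · rw [h]; exact (hall s hs hs').symm
    have hra : r ≠ a := fun e => by
      rw [e] at hpr
      exact hpb (huniqA p b hvp hvb (by rw [bond_symm]; exact hpr) hab)
    have hrp : r ≠ p := (ne_of_bond hpr).symm
    -- `r = z` or `r = p'`
    rcases memP5 r hvr with e | e | e | e | e
    · exact hra e
    · -- `r = z`: the last partner `p'` has no room for two bonded partners
      rw [e] at hpr hallp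
      obtain ⟨u₁, u₂, -, hvu₁, -, hp'u₁, -, -⟩ := hdeg2 p' hvp' hp'a hp'z
      rcases memP5 u₁ hvu₁ with f | f | f | f | f <;> rw [f] at hp'u₁
      · exact hp'b (huniqA p' b hvp' hvb (by rw [bond_symm]; exact hp'u₁) hab)
      · exact hpp'.symm (huniqZ p' p hvp' hvp (by rw [bond_symm]; exact hp'u₁)
          (by rw [bond_symm]; exact hpr))
      · rcases hallb p' hvp' (by rw [bond_symm]; exact hp'u₁) with g | g
        · exact hp'a g
        · exact hpp'.symm g
      · rcases hallp p' hvp' (by rw [bond_symm]; exact hp'u₁) with g | g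
        · exact hp'b g
        · exact hp'z g
      · exact (ne_of_bond hp'u₁) rfl
    · exact hrb e
    · exact hrp e
    · -- `r = p'`: the path `a – b – p – p' – z`
      rw [e] at hpr hallp
      obtain ⟨s, hsp, hvs, hp's, -⟩ : ∃ s, s ≠ p ∧ bond v s = true ∧ bond p' s = true ∧ True := by
        obtain ⟨s₁, s₂, h12, hvs₁, hvs₂, hps₁, hps₂, hall⟩ := hdeg2 p' hvp' hp'a hp'z
        rcases hall p hvp (by rw [bond_symm]; exact hpr) with h | h
        · exact ⟨s₂, by rw [h]; exact h12.symm, hvs₂, hps₂, trivial⟩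
        · exact ⟨s₁, by rw [h]; exact h12, hvs₁, hps₁, trivial⟩
      have hsz : s = z := by
        rcases memP5 s hvs with f | f | f | f | f
        · rw [f] at hp's
          exact absurd (huniqA p' b hvp' hvb (by rw [bond_symm]; exact hp's) hab) hp'b
        · exact f
        · rw [f] at hp's
          rcases hallb p' hvp' (by rw [bond_symm]; exact hp's) with g | g
          · exact absurd g hp'a
          · exact absurd g hpp'.symm
        · exact absurd f hsp
        · rw [f] at hp's
          exact absurd rfl (ne_of_bond hp's)
      rw [hsz] at hp's
      have hinj : Function.Injective ![v, z, p', p, b, a, x] := by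
        apply List.nodup_ofFn.mp
        simp [List.ofFn_succ, (ne_of_bond hvz), (ne_of_bond hvp'), (ne_of_bond hvp), (ne_of_bond hvb),
          (ne_of_bond hva), hxv.symm, hp'z.symm, hpz.symm, hbz.symm, haz.symm, (ne_x hvz), hpp'.symm,
          hp'b, hp'a, (ne_x hvp'), hpb, hpa, (ne_x hvp), hba, (ne_x hvb), (ne_x hva)]
      exact noOpenStar v z p' p b a x hinj hvz hvp' hvp hvb hva (by rw [bond_symm]; exact hp's)
        (by rw [bond_symm]; exact hpr) (by rw [bond_symm]; exact hbp) hab' hazb hxa hxz hvx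
  -- `m` is `z`, `p` or `p'`
  rcases memP5 m hvm with e | e | e | e | e
  · exact hma e
  · -- `m = z`: the partner `p` has no room for two bonded partners
    rw [e] at hbm hallb
    obtain ⟨t₁, t₂, h12, hvt₁, hvt₂, hpt₁, hpt₂, -⟩ := hdeg2 p hvp hpa hpz
    have only : ∀ t, bond v t = true → bond p t = true → t = p' := by
      intro t hvt hpt
      rcases memP5 t hvt with f | f | f | f | f <;> rw [f] at hpt
      · exact absurd (huniqA p b hvp hvb (by rw [bond_symm]; exact hpt) hab) hpb
      · exact absurd (huniqZ p b hvp hvb (by rw [bond_symm]; exact hpt)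
          (by rw [bond_symm]; exact hbm)) hpb
      · rcases hallb p hvp (by rw [bond_symm]; exact hpt) with g | g
        · exact absurd g hpa
        · exact absurd g hpz
      · exact absurd rfl (ne_of_bond hpt)
      · exact f
    exact h12 ((only t₁ hvt₁ hpt₁).trans (only t₂ hvt₂ hpt₂).symm)
  · exact hmb e
  · rw [e] at hbm hallb
    exact tail p p' hvp hpa hpz hpb hvp' hp'a hp'z hp'b hpp' memP5 hbm hallb
  · rw [e] at hbm hallb
    refine tail p' p hvp' hp'a hp'z hp'b hvp hpa hpz hpb hpp'.symm (fun w hw => ?_) hbm hallb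
    rcases memP5 w hw with h | h | h | h | h
    · exact Or.inl h
    · exact Or.inr (Or.inl h)
    · exact Or.inr (Or.inr (Or.inl h))
    · exact Or.inr (Or.inr (Or.inr (Or.inr h)))
    · exact Or.inr (Or.inr (Or.inr (Or.inl h)))

end Summit.AtomisticToContinuum.Crystallization.Theorems

end
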